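import Literature.NumberTheory.Sieve.AletheiaZomleferFukshanskyGarcia2020Applications
import Literature.NumberTheory.Sieve.SingularSeriesProofs
import HarnessLib

/-!
# Discharge of `tendsto_primePairConstPartial` (AZFG 2020, §7.2): the products defining the prime-pair constants `C_k` converge

Topic `Literature/NumberTheory/Sieve`. Sibling proof file of
`AletheiaZomleferFukshanskyGarcia2020Applications.lean` (S. L. Aletheia-Zomlefer, L. Fukshansky,
S. R. Garcia, *The Bateman–Horn conjecture: heuristics, history, and applications*, Expo. Math. 38
(2020) = arXiv:1807.08899; locators are those of arXiv v4, as in the statement file); everything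
here is PROVED (no named facts, no `sorry`).

The statement file records as a named fact (`Literature.NumberTheory.Sieve.tendsto_primePairConstPartial`)
that for even `k ≥ 2` the ordered partial products
`primePairConstPartial k x = ∏_{p ≤ x, p ∤ k} p(p-2)/(p-1)²` of the second factor of
`C_k = ∏_{p ∣ k, p ≥ 3} p/(p-1) · ∏_{p ∤ k} p(p-2)/(p-1)²` (display (7.2.2)) converge to a positive
limit. The source (§7.2, the sentence carrying display (7.2.3)): "Since `∑_p 1/p²` converges, the
infinite product (7.2.2) that defines `C_k` converges absolutely since
`p(p-2)/(p-1)² = 1 - 1/(p-1)²`", and (second observation after (7.2.3)) "`C_k` is minimized when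
`k` is a power of two, in which case `C₂ = C₄ = C₈ = C₁₆ = ⋯ ≈ 0.660162`".

Proof (`tendsto_primePairConstPartial_holds`). We follow the ordered-partial-product route already
used for the twin prime constant `C₂` in `Literature/NumberTheory/Sieve/SingularSeriesProofs.lean`
(`tendsto_twinPrimeConstPartial_holds`):

* for even `k` every prime `p ∤ k` is odd, so by (7.2.3) each factor is `1 - 1/(p-1)²` with
  `p ≥ 3`, which lies in `[0, 1]` (`twinPrimeConstFactor_nonneg`, `twinPrimeConstFactor_le_one`);
  hence `x ↦ primePairConstPartial k x` is antitone (`primePairConstPartial_antitone`);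
* `{p ≤ x : p ∤ k} ⊆ {p ≤ x : 2 < p}` and the omitted factors are `≤ 1`, so
  `twinPrimeConstPartial x ≤ primePairConstPartial k x` — the partial-product form of "`C_k` is
  minimized when `k` is a power of two" — and `1/2 ≤ twinPrimeConstPartial x`
  (`half_le_twinPrimeConstPartial`) gives a uniform positive lower bound;
* an antitone sequence bounded below converges to its infimum (Mathlib `tendsto_atTop_ciInf`),
  which is `≥ 1/2 > 0`.

Corollaries: `limUnder atTop (primePairConstPartial k)` is that limit
(`limUnder_primePairConstPartial`), so `0 < primePairConst k` for even `k` (`primePairConst_pos`).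

## Bateman–Horn ⇒ `π_k(x) ∼ 2C_k x/(log x)²` and Polignac's conjecture (third part of the file)

* `Literature.NumberTheory.Sieve.primePairCount_isEquivalent_of_batemanHorn_holds` — discharge of
  the named fact `primePairCount_isEquivalent_of_batemanHorn` (§7.2, display for `π_k(x)` after
  (7.2.3)): the system `t`, `t + k` satisfies the Bateman–Horn hypotheses for even `k ≠ 0`
  (`isBatemanHornSystem_primePair`), the conjecture's constant is `2C_k` by
  `hasBatemanHornConst_primePair_holds` and uniqueness of limits, and `Q(t, t+k; x) = π_k(x)`
  (`polyPrimeCount_primePair`).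
* `Literature.NumberTheory.Sieve.polignac_of_batemanHorn` — §7.2: Bateman–Horn "implies the
  existence of infinitely many pairs `p, p+k` of primes for each even `k`" (Polignac's conjecture),
  from the asymptotic and `primePairConst_pos`.

## References

* S. L. Aletheia-Zomlefer, L. Fukshansky, S. R. Garcia, *The Bateman–Horn conjecture: heuristics,
  history, and applications*, Expo. Math. 38 (2020) 430–479, §7.2, displays (7.2.2)–(7.2.3) and the
  observations following (7.2.3). [AletheiaZomleferFukshanskyGarcia2020]
* G. H. Hardy, J. E. Littlewood, *Some problems of 'Partitio numerorum'; III*, Acta Math. 44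
  (1923), 1–70 (the constants `C₂`, `C_k`). [HardyLittlewood1923]
-/

noncomputable section

open Filter Finset
open scoped Topology

namespace Literature.NumberTheory.Sieve

/-- **§7.2, display (7.2.3)**: `p(p-2)/(p-1)² = 1 - 1/(p-1)²` (for a natural number `p ≥ 2`, in `ℝ`).
[cite: AletheiaZomleferFukshanskyGarcia2020, §7.2 (7.2.3)] -/
theorem primePairConstFactor_eq {p : ℕ} (hp : 2 ≤ p) :
    (p : ℝ) * ((p : ℝ) - 2) / ((p : ℝ) - 1) ^ 2 = 1 - 1 / ((p : ℝ) - 1) ^ 2 := by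
  have h1 : (p : ℝ) - 1 ≠ 0 := by
    have : (2 : ℝ) ≤ p := by exact_mod_cast hp
    linarith
  field_simp
  ring

/-- By (7.2.3) the partial products of the second factor of `C_k` are
`∏_{p ≤ x, p ∤ k} (1 - 1/(p-1)²)`. [cite: AletheiaZomleferFukshanskyGarcia2020, §7.2 (7.2.2)–(7.2.3)] -/
theorem primePairConstPartial_eq_prod_one_sub (k x : ℕ) :
    primePairConstPartial k x =
      ∏ p ∈ (Nat.primesLE x).filter (¬· ∣ k), (1 - 1 / ((p : ℝ) - 1) ^ 2) := by
  unfold primePairConstPartial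
  refine prod_congr rfl fun p hp ↦ ?_
  simp only [mem_filter, Nat.mem_primesLE] at hp
  exact primePairConstFactor_eq hp.1.2.two_le

/-- For even `k`, a prime `p ∤ k` is odd, so every prime indexing `primePairConstPartial k x` is
`≥ 3`. [folklore] -/
theorem three_le_of_mem_primesLE_filter_not_dvd {k : ℕ} (hk : Even k) {x p : ℕ}
    (hp : p ∈ (Nat.primesLE x).filter (¬· ∣ k)) : 3 ≤ p := by
  simp only [mem_filter, Nat.mem_primesLE] at hp
  obtain ⟨⟨-, hpp⟩, hpk⟩ := hp
  have h2 : p ≠ 2 := by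
    rintro rfl
    exact hpk (even_iff_two_dvd.mp hk)
  have := hpp.two_le
  omega

/-- For even `k`, `x ↦ ∏_{p ≤ x, p ∤ k} p(p-2)/(p-1)²` is non-increasing (every factor
`1 - 1/(p-1)²`, `p ≥ 3`, lies in `[0, 1]`). [cite: AletheiaZomleferFukshanskyGarcia2020, §7.2 (7.2.3)] -/
theorem primePairConstPartial_antitone {k : ℕ} (hk : Even k) :
    Antitone (primePairConstPartial k) := by
  intro x y hxy
  rw [primePairConstPartial_eq_prod_one_sub, primePairConstPartial_eq_prod_one_sub]
  apply Finset.prod_le_prod_of_subset_of_le_one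
  · intro p hp
    simp only [Finset.mem_filter, Nat.mem_primesLE] at hp ⊢
    exact ⟨⟨hp.1.1.trans hxy, hp.1.2⟩, hp.2⟩
  · intro p hp
    exact twinPrimeConstFactor_nonneg (three_le_of_mem_primesLE_filter_not_dvd hk hp)
  · intro p _ _
    exact twinPrimeConstFactor_le_one p

/-- For even `k` the partial products of `C_k`'s second factor dominate those of `C₂`:
`∏_{2 < p ≤ x} (1 - 1/(p-1)²) ≤ ∏_{p ≤ x, p ∤ k} (1 - 1/(p-1)²)` (the primes `p ∤ k` are among
the odd primes, and the omitted factors are `≤ 1`) — the partial-product form of the source's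
"`C_k` is minimized when `k` is a power of two".
[cite: AletheiaZomleferFukshanskyGarcia2020, §7.2 (second observation after (7.2.3))] -/
theorem twinPrimeConstPartial_le_primePairConstPartial {k : ℕ} (hk : Even k) (x : ℕ) :
    twinPrimeConstPartial x ≤ primePairConstPartial k x := by
  rw [primePairConstPartial_eq_prod_one_sub]
  unfold twinPrimeConstPartial
  apply Finset.prod_le_prod_of_subset_of_le_one
  · intro p hp
    have h3 := three_le_of_mem_primesLE_filter_not_dvd hk hp
    simp only [Finset.mem_filter, Nat.mem_primesLE] at hp ⊢
    exact ⟨hp.1, by omega⟩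
  · intro p hp
    simp only [Finset.mem_filter, Nat.mem_primesLE] at hp
    exact twinPrimeConstFactor_nonneg (by omega)
  · intro p _ _
    exact twinPrimeConstFactor_le_one p

/-- Uniform lower bound: `1/2 ≤ ∏_{p ≤ x, p ∤ k} p(p-2)/(p-1)²` for even `k`
(via `half_le_twinPrimeConstPartial`). [folklore] -/
theorem half_le_primePairConstPartial {k : ℕ} (hk : Even k) (x : ℕ) :
    1 / 2 ≤ primePairConstPartial k x :=
  (half_le_twinPrimeConstPartial x).trans (twinPrimeConstPartial_le_primePairConstPartial hk x)

/-- For even `k` the partial products of `C_k`'s second factor converge to their infimum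
(antitone and bounded below; Mathlib `tendsto_atTop_ciInf`). [folklore] -/
theorem tendsto_primePairConstPartial_ciInf {k : ℕ} (hk : Even k) :
    Tendsto (primePairConstPartial k) atTop (𝓝 (⨅ x, primePairConstPartial k x)) :=
  tendsto_atTop_ciInf (primePairConstPartial_antitone hk)
    ⟨1 / 2, by rintro _ ⟨x, rfl⟩; exact half_le_primePairConstPartial hk x⟩

/-- The infimum (= limit) of the partial products is at least `1/2`, in particular positive.
[folklore] -/
theorem half_le_ciInf_primePairConstPartial {k : ℕ} (hk : Even k) :
    1 / 2 ≤ ⨅ x, primePairConstPartial k x :=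
  le_ciInf (half_le_primePairConstPartial hk)

/-- For even `k` the ordered limit in `primePairConst k` is a genuine limit:
`limUnder atTop (primePairConstPartial k) = ⨅ x, primePairConstPartial k x`
(Mathlib `Filter.Tendsto.limUnder_eq`). [folklore] -/
theorem limUnder_primePairConstPartial {k : ℕ} (hk : Even k) :
    limUnder atTop (primePairConstPartial k) = ⨅ x, primePairConstPartial k x :=
  (tendsto_primePairConstPartial_ciInf hk).limUnder_eq

/-- **§7.2 discharged** (`tendsto_primePairConstPartial`): for even `k ≥ 2` the product (7.2.2)
defining `C_k` converges — as an ordered product, to a positive limit (`≥ 1/2`). The source argues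
absolute convergence from (7.2.3) and `∑ 1/p² < ∞`; here, as for `C₂`
(`tendsto_twinPrimeConstPartial_holds`), the partial products are non-increasing and bounded below
by `twinPrimeConstPartial x ≥ 1/2`. (The hypothesis `k ≠ 0` is not needed: for `k = 0` the
product is empty.) [cite: AletheiaZomleferFukshanskyGarcia2020, §7.2 (7.2.2)–(7.2.3)] -/
theorem tendsto_primePairConstPartial_holds : tendsto_primePairConstPartial := by
  intro k hk _
  refine ⟨⨅ x, primePairConstPartial k x, ?_, tendsto_primePairConstPartial_ciInf hk⟩
  have := half_le_ciInf_primePairConstPartial hk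
  linarith

/-- Consequently `C_k ≥ 1/2 · ∏_{p ∣ k, p ≥ 3} p/(p-1) > 0` for even `k`; in particular
`0 < primePairConst k`. [cite: AletheiaZomleferFukshanskyGarcia2020, §7.2 (7.2.2)] -/
theorem primePairConst_pos {k : ℕ} (hk : Even k) : 0 < primePairConst k := by
  unfold primePairConst
  rw [limUnder_primePairConstPartial hk]
  refine mul_pos (prod_pos fun p hp ↦ ?_) ?_
  · simp only [mem_filter, Nat.mem_primeFactors] at hp
    have h3 : (3 : ℝ) ≤ p := by exact_mod_cast hp.2
    have h1 : (0 : ℝ) < (p : ℝ) - 1 := by linarith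
    positivity
  · have := half_le_ciInf_primePairConstPartial hk
    linarith

/-!
## Discharge of `hasBatemanHornConst_primePair` (AZFG 2020, §7.2, displays (7.2.1)–(7.2.2))

The statement file also records as a named fact
(`Literature.NumberTheory.Sieve.hasBatemanHornConst_primePair`) display (7.2.1) of the source: for
even `k ≥ 2` and `f₁ = t`, `f₂ = t + k`, the Bateman–Horn constant is
`C(f₁, f₂) = ∏_{p ∣ k} p/(p-1) · ∏_{p ∤ k} p(p-2)/(p-1)² = 2 C_k`, vendored (D-SIEVE-1) as
`HasBatemanHornConst ![t, t + k] (2 * primePairConst k)`: the ordered partial products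
`∏_{p ≤ x} (1 - 1/p)⁻² (1 - ω_f(p)/p)` converge to `2 C_k`, where the infinite product in
`C_k = primePairConst k` is the ordered limit `limUnder atTop (primePairConstPartial k)`.
It is discharged below (`hasBatemanHornConst_primePair_holds`), following the source's computation:

1. `ω_f(p) = 1` if `p ∣ k` and `ω_f(p) = 2` if `p ∤ k` (`polyRootCountMod_primePair`: the roots of
   `t(t + k) ≡ 0 (mod p)` are `t ≡ 0` and `t ≡ -k`, which coincide iff `p ∣ k`);
2. hence the local factor is `(1 - 1/p)⁻² (1 - 1/p) = p/(p-1)` at `p ∣ k` and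
   `(1 - 1/p)⁻² (1 - 2/p) = p(p-2)/(p-1)²` at `p ∤ k` (`batemanHornFactor_primePair_of_dvd`,
   `batemanHornFactor_primePair_of_not_dvd`); for `x ≥ k` the primes `p ≤ x` dividing `k` are
   exactly the prime factors of `k` and the factor at `p = 2 ∣ k` is `2/(2-1) = 2`, so the partial
   product over `p ≤ x` equals `2 · ∏_{p ∣ k, p ≥ 3} p/(p-1) · primePairConstPartial k x`
   (`batemanHornPartial_primePair`, display (7.2.1) at the level of partial products);
3. the last factor converges to `⨅ x, primePairConstPartial k x = limUnder atTop (primePairConstPartial k)`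
   (`tendsto_primePairConstPartial_ciInf`, `limUnder_primePairConstPartial` above).
-/

open Polynomial

/-- **§7.2** (display for `ω_f`): for `f₁ = t`, `f₂ = t + k` and a prime `p`, `ω_f(p) = 1` if
`p ∣ k` and `ω_f(p) = 2` if `p ∤ k` (the roots of `t(t + k) ≡ 0 (mod p)` are `t ≡ 0` and
`t ≡ -k`, which coincide iff `p ∣ k`). PROVED, for every `k : ℕ`.
[cite: AletheiaZomleferFukshanskyGarcia2020, §7.2 (display for ω_f(p))] -/
theorem polyRootCountMod_primePair (k : ℕ) {p : ℕ} (hp : p.Prime) :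
    polyRootCountMod ![(X : ℤ[X]), X + C (k : ℤ)] p = if p ∣ k then 1 else 2 := by
  haveI := Fact.mk hp
  unfold polyRootCountMod
  simp only [Fin.prod_univ_two, Matrix.cons_val_zero, Matrix.cons_val_one, eval_X, eval_add,
    eval_C]
  have hcast : ∀ n : ℕ, ((p : ℤ) ∣ (n : ℤ) * ((n : ℤ) + (k : ℤ))) ↔
      ((n : ZMod p) * ((n : ZMod p) + (k : ZMod p)) = 0) := by
    intro n
    rw [← ZMod.intCast_zmod_eq_zero_iff_dvd]
    push_cast
    rfl
  simp_rw [hcast]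
  have hval : ∀ n < p, ((n : ZMod p)).val = n := fun n hn ↦ ZMod.val_natCast_of_lt hn
  split_ifs with hpk
  · have hk0 : (k : ZMod p) = 0 := (ZMod.natCast_eq_zero_iff k p).mpr hpk
    have hset : (range p).filter
        (fun n : ℕ ↦ (n : ZMod p) * ((n : ZMod p) + (k : ZMod p)) = 0) = {0} := by
      ext n
      simp only [mem_filter, mem_range, mem_singleton, hk0, add_zero, mul_self_eq_zero]
      constructor
      · rintro ⟨hn, h0⟩
        rw [← hval n hn, h0, ZMod.val_zero]
      · rintro rfl
        exact ⟨hp.pos, Nat.cast_zero⟩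
    rw [hset, card_singleton]
  · have hk0 : (k : ZMod p) ≠ 0 := by rwa [Ne, ZMod.natCast_eq_zero_iff]
    set r : ZMod p := -(k : ZMod p) with hr
    have hr0 : r.val ≠ 0 := by
      rw [Ne, ZMod.val_eq_zero, hr, neg_eq_zero]
      exact hk0
    have hset : (range p).filter
        (fun n : ℕ ↦ (n : ZMod p) * ((n : ZMod p) + (k : ZMod p)) = 0) = {0, r.val} := by
      ext n
      simp only [mem_filter, mem_range, mem_insert, mem_singleton, mul_eq_zero]
      constructor
      · rintro ⟨hn, h0 | h0⟩
        · left
          rw [← hval n hn, h0, ZMod.val_zero]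
        · right
          rw [← hval n hn]
          congr 1
          rw [hr]
          linear_combination h0
      · rintro (rfl | rfl)
        · exact ⟨hp.pos, Or.inl Nat.cast_zero⟩
        · refine ⟨ZMod.val_lt r, Or.inr ?_⟩
          rw [ZMod.natCast_zmod_val, hr, neg_add_cancel]
    rw [hset, card_pair (Ne.symm hr0)]

/-- The local Bateman–Horn factor at a prime `p ∣ k`:
`(1 - 1/p)⁻² (1 - ω_f(p)/p) = (1 - 1/p)⁻¹ = p/(p-1)` (`ω_f(p) = 1`).
[cite: AletheiaZomleferFukshanskyGarcia2020, §7.2 (7.2.1), factors at p ∣ k] -/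
theorem batemanHornFactor_primePair_of_dvd {k p : ℕ} (hp : p.Prime) (hpk : p ∣ k) :
    (1 - 1 / (p : ℝ))⁻¹ ^ 2 * (1 - (polyRootCountMod ![(X : ℤ[X]), X + C (k : ℤ)] p : ℝ) / p) =
      (p : ℝ) / ((p : ℝ) - 1) := by
  rw [polyRootCountMod_primePair k hp, if_pos hpk]
  have h0 : (p : ℝ) ≠ 0 := by exact_mod_cast hp.ne_zero
  have h1 : (p : ℝ) - 1 ≠ 0 := by
    have : (1 : ℝ) < p := by exact_mod_cast hp.one_lt
    linarith
  push_cast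
  field_simp

/-- The local Bateman–Horn factor at a prime `p ∤ k`:
`(1 - 1/p)⁻² (1 - ω_f(p)/p) = (1 - 1/p)⁻² (1 - 2/p) = p(p-2)/(p-1)²` (`ω_f(p) = 2`).
[cite: AletheiaZomleferFukshanskyGarcia2020, §7.2 (7.2.1), factors at p ∤ k] -/
theorem batemanHornFactor_primePair_of_not_dvd {k p : ℕ} (hp : p.Prime) (hpk : ¬p ∣ k) :
    (1 - 1 / (p : ℝ))⁻¹ ^ 2 * (1 - (polyRootCountMod ![(X : ℤ[X]), X + C (k : ℤ)] p : ℝ) / p) =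
      (p : ℝ) * ((p : ℝ) - 2) / ((p : ℝ) - 1) ^ 2 := by
  rw [polyRootCountMod_primePair k hp, if_neg hpk]
  have h0 : (p : ℝ) ≠ 0 := by exact_mod_cast hp.ne_zero
  have h1 : (p : ℝ) - 1 ≠ 0 := by
    have : (1 : ℝ) < p := by exact_mod_cast hp.one_lt
    linarith
  push_cast
  field_simp

/-- For `k ≠ 0` and `x ≥ k`, the primes `p ≤ x` dividing `k` are exactly the prime factors of `k`
(so for `x ≥ k` the first product in (7.2.1) is complete). [folklore] -/
theorem primesLE_filter_dvd {k x : ℕ} (hk0 : k ≠ 0) (hx : k ≤ x) :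
    (Nat.primesLE x).filter (· ∣ k) = k.primeFactors := by
  ext p
  simp only [mem_filter, Nat.mem_primesLE, Nat.mem_primeFactors, ne_eq]
  constructor
  · rintro ⟨⟨-, hp⟩, hpk⟩
    exact ⟨hp, hpk, hk0⟩
  · rintro ⟨hp, hpk, -⟩
    exact ⟨⟨(Nat.le_of_dvd (Nat.pos_of_ne_zero hk0) hpk).trans hx, hp⟩, hpk⟩

/-- **§7.2, display (7.2.1)** at the level of ordered partial products: for even `k ≥ 2` and
`x ≥ k`,
`∏_{p ≤ x} (1 - 1/p)⁻² (1 - ω_f(p)/p) = ∏_{p ∣ k} p/(p-1) · ∏_{p ≤ x, p ∤ k} p(p-2)/(p-1)²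
 = 2 · ∏_{p ∣ k, p ≥ 3} p/(p-1) · ∏_{p ≤ x, p ∤ k} p(p-2)/(p-1)²`
(the factor at `p = 2 ∣ k` is `2/(2-1) = 2`, whence the source's normalisation `C(f₁, f₂) = 2C_k`,
(7.2.2)). PROVED. [cite: AletheiaZomleferFukshanskyGarcia2020, §7.2 (7.2.1)–(7.2.2)] -/
theorem batemanHornPartial_primePair {k : ℕ} (hk : Even k) (hk0 : k ≠ 0) {x : ℕ} (hx : k ≤ x) :
    batemanHornPartial ![(X : ℤ[X]), X + C (k : ℤ)] x =
      2 * (∏ p ∈ k.primeFactors.filter (2 < ·), (p : ℝ) / ((p : ℝ) - 1)) *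
        primePairConstPartial k x := by
  unfold batemanHornPartial primePairConstPartial
  rw [Fintype.card_fin, ← prod_filter_mul_prod_filter_not (Nat.primesLE x) (· ∣ k)]
  congr 1
  · rw [primesLE_filter_dvd hk0 hx, prod_congr rfl fun p hp ↦ batemanHornFactor_primePair_of_dvd
      (Nat.prime_of_mem_primeFactors hp) (Nat.dvd_of_mem_primeFactors hp),
      ← prod_filter_mul_prod_filter_not k.primeFactors (2 < ·), mul_comm]
    congr 1
    have h2 : k.primeFactors.filter (fun p ↦ ¬2 < p) = {2} := by
      ext p
      simp only [mem_filter, Nat.mem_primeFactors, mem_singleton, not_lt, ne_eq]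
      constructor
      · rintro ⟨⟨hp, -, -⟩, hp2⟩
        exact le_antisymm hp2 hp.two_le
      · rintro rfl
        exact ⟨⟨Nat.prime_two, hk.two_dvd, hk0⟩, le_rfl⟩
    rw [h2, prod_singleton]
    norm_num
  · refine prod_congr rfl fun p hp ↦ ?_
    simp only [mem_filter, Nat.mem_primesLE] at hp
    exact batemanHornFactor_primePair_of_not_dvd hp.1.2 hp.2

/-- **§7.2 discharged** (`hasBatemanHornConst_primePair`, displays (7.2.1)–(7.2.2)): for even
`k ≥ 2`, `C(t, t + k) = 2 C_k` as an ordered limit, i.e. the Bateman–Horn partial products of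
`![t, t + k]` converge to `2 · primePairConst k`. By `batemanHornPartial_primePair` they are
eventually `2 · ∏_{p ∣ k, p ≥ 3} p/(p-1) · primePairConstPartial k x`, and the last factor
converges to `limUnder atTop (primePairConstPartial k)` (`tendsto_primePairConstPartial_ciInf`,
`limUnder_primePairConstPartial`). [cite: AletheiaZomleferFukshanskyGarcia2020, §7.2 (7.2.1)–(7.2.2)] -/
theorem hasBatemanHornConst_primePair_holds : hasBatemanHornConst_primePair := by
  intro k hk hk0
  unfold HasBatemanHornConst primePairConst
  rw [limUnder_primePairConstPartial hk, ← mul_assoc]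
  refine ((tendsto_primePairConstPartial_ciInf hk).const_mul _).congr' ?_
  filter_upwards [eventually_ge_atTop k] with x hx
  exact (batemanHornPartial_primePair hk hk0 hx).symm

/-!
## Discharge of `primePairCount_isEquivalent_of_batemanHorn` (AZFG 2020, §7.2, display for `π_k(x)`)

The statement file records as a named fact
(`Literature.NumberTheory.Sieve.primePairCount_isEquivalent_of_batemanHorn`) the prediction of §7.2
(the display after (7.2.3)): the Bateman–Horn conjecture implies
`π_k(x) ∼ 2C_k ∫₂ˣ dt/(log t)² ∼ 2C_k x/(log x)²` for every even `k ≥ 2` (vendored in the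
`x/(log x)²` form, as the tree's `BatemanHornConjecture`). It is discharged below
(`primePairCount_isEquivalent_of_batemanHorn_holds`):

1. the system `f₁ = t`, `f₂ = t + k` satisfies the hypotheses of the conjecture for even `k ≠ 0`
   (`isBatemanHornSystem_primePair`): `t` and `t + k` are irreducible with leading coefficient
   `1`, non-associated since `k ≠ 0`, and `ω_f(p) < p` for every prime `p` by
   `polyRootCountMod_primePair` (`ω_f(p) = 1` at `p ∣ k`, in particular at `p = 2`, and
   `ω_f(p) = 2 < p` at `p ∤ k`, where `p ≥ 3` as `k` is even);
2. the conjecture then yields a constant `C` with `HasBatemanHornConst ![t, t + k] C` and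
   `Q(t, t + k; x) ∼ C/(1·1) · x/(log x)²`; by `hasBatemanHornConst_primePair_holds` and uniqueness
   of limits in `ℝ`, `C = 2C_k`;
3. `Q(t, t + k; x) = π_k(x)` (`polyPrimeCount_primePair`; the source: "`π_k(x)` denotes the number
   of primes `p ≤ x` for which `p + k` is prime").

As the source remarks at the start of §7.2, this gives Polignac's conjecture (1849) from
Bateman–Horn (`polignac_of_batemanHorn`, via `primePairConst_pos` and `x/(log x)² → ∞`).
-/

open Asymptotics

/-- The prime-pair system `t`, `t + k` satisfies the Bateman–Horn hypotheses for even `k ≠ 0`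
(`t`, `t + k` irreducible, monic, non-associated as `k ≠ 0`; `ω_f(p) = 1 < p` for `p ∣ k`, in
particular for `p = 2`, and `ω_f(p) = 2 < p` for `p ∤ k`, which forces `p ≥ 3`).
[cite: AletheiaZomleferFukshanskyGarcia2020, §7.2 (f₁ = t, f₂ = t + k)] -/
theorem isBatemanHornSystem_primePair {k : ℕ} (hk : Even k) (hk0 : k ≠ 0) :
    IsBatemanHornSystem ![(X : ℤ[X]), X + C (k : ℤ)] where
  irreducible i := by
    fin_cases i
    · exact prime_X.irreducible
    · simpa using irreducible_X_sub_C (-(k : ℤ))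
  leadingCoeff_pos i := by
    fin_cases i
    · simp
    · show 0 < ((X : ℤ[X]) + C (k : ℤ)).leadingCoeff
      rw [(monic_X_add_C (k : ℤ)).leadingCoeff]
      exact one_pos
  pairwise_not_associated := by
    have key : ¬Associated (X : ℤ[X]) (X + C (k : ℤ)) := by
      intro h
      have h1 := X_dvd_iff.mp h.dvd
      simp at h1
      exact hk0 h1
    intro i j hij
    fin_cases i <;> fin_cases j
    · exact absurd rfl hij
    · simpa using key
    · simpa using fun h ↦ key h.symm
    · exact absurd rfl hij
  hasNoFixedPrimeDivisor p hp := by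
    rw [polyRootCountMod_primePair k hp]
    split_ifs with h
    · exact hp.one_lt
    · have h2 : p ≠ 2 := by
        rintro rfl
        exact h (even_iff_two_dvd.mp hk)
      have := hp.two_le
      omega

/-- `Q(t, t + k; x) = π_k(x)` (`primePairCount k x`, the number of `p ≤ x` with `p` and `p + k`
prime; the term `n = 0` of `polyPrimeCount` is excluded on both sides as `0` is not prime).
[cite: AletheiaZomleferFukshanskyGarcia2020, §7.2 (π_k(x))] -/
theorem polyPrimeCount_primePair (k x : ℕ) :
    polyPrimeCount ![(X : ℤ[X]), X + C (k : ℤ)] x = primePairCount k x := by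
  unfold polyPrimeCount primePairCount
  congr 1
  ext n
  simp only [mem_filter, mem_range, Fin.forall_fin_two, Matrix.cons_val_zero, Matrix.cons_val_one,
    eval_X, eval_add, eval_C, Int.toNat_natCast]
  have h2 : ((n : ℤ) + (k : ℤ)).toNat = n + k := by
    rw [show ((n : ℤ) + (k : ℤ)) = ((n + k : ℕ) : ℤ) by push_cast; ring, Int.toNat_natCast]
  rw [h2]
  constructor
  · rintro ⟨hn, ⟨-, hp⟩, -, hq⟩
    exact ⟨hn, hp, hq⟩
  · rintro ⟨hn, hp, hq⟩
    exact ⟨hn, ⟨by exact_mod_cast hp.pos, hp⟩, by exact_mod_cast hq.pos, hq⟩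

/-- **§7.2 discharged: Bateman–Horn ⇒ `π_k(x) ∼ 2C_k x/(log x)²` for every even `k ≥ 2`**
(`primePairCount_isEquivalent_of_batemanHorn`). From the conjecture for the system `t`, `t + k`
(`isBatemanHornSystem_primePair`) we get a constant `C` with `HasBatemanHornConst ![t, t+k] C` and
`Q(t, t+k; x) ∼ C x/(log x)²`; `C = 2C_k` by `hasBatemanHornConst_primePair_holds` ((7.2.1)) and
uniqueness of limits, and `Q(t, t+k; x) = π_k(x)` (`polyPrimeCount_primePair`).
[cite: AletheiaZomleferFukshanskyGarcia2020, §7.2 (display for π_k(x) after (7.2.3))] -/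
theorem primePairCount_isEquivalent_of_batemanHorn_holds :
    primePairCount_isEquivalent_of_batemanHorn := by
  intro hBH k hk hk0
  obtain ⟨C₀, hC, hQ⟩ := hBH 2 ![(X : ℤ[X]), X + C (k : ℤ)] (isBatemanHornSystem_primePair hk hk0)
  have hCeq : C₀ = 2 * primePairConst k :=
    tendsto_nhds_unique hC (hasBatemanHornConst_primePair_holds k hk hk0)
  have hdeg : ((X : ℤ[X]) + C (k : ℤ)).natDegree = 1 := natDegree_X_add_C (k : ℤ)
  convert hQ using 2 with x x
  · rw [polyPrimeCount_primePair]
  · simp only [Fin.prod_univ_two, Fintype.card_fin, Matrix.cons_val_zero, Matrix.cons_val_one,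
      natDegree_X, hdeg, Nat.cast_one, mul_one, div_one, hCeq]

/-- **§7.2**: the Bateman–Horn conjecture "implies the existence of infinitely many pairs
`p, p + k` of primes for each even `k`" (Polignac's conjecture, 1849), since
`π_k(x) ∼ 2C_k x/(log x)² → ∞` (`primePairCount_isEquivalent_of_batemanHorn_holds`, `C_k > 0` by
`primePairConst_pos`). [cite: AletheiaZomleferFukshanskyGarcia2020, §7.2 (Polignac's conjecture from Bateman–Horn)] -/
theorem polignac_of_batemanHorn (hBH : BatemanHornConjecture) {k : ℕ} (hk : Even k) (hk0 : k ≠ 0) :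
    {p : ℕ | p.Prime ∧ (p + k).Prime}.Infinite := by
  have hlim : Tendsto (fun x : ℕ ↦ (primePairCount k x : ℝ)) atTop atTop := by
    refine (primePairCount_isEquivalent_of_batemanHorn_holds hBH k hk hk0).symm.tendsto_atTop ?_
    have := tendsto_natCast_div_log_sq_atTop.const_mul_atTop
      (mul_pos two_pos (primePairConst_pos hk))
    simpa [mul_div_assoc] using this
  refine Set.infinite_of_forall_exists_gt fun n ↦ ?_
  by_contra hcon
  push Not at hcon
  have hbound : ∀ x, (primePairCount k x : ℝ) ≤ (n + 1 : ℕ) := by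
    intro x
    unfold primePairCount
    exact_mod_cast (card_le_card (fun p hp ↦ by
      simp only [mem_filter, mem_range] at hp ⊢
      have := hcon p hp.2
      omega)).trans (card_range (n + 1)).le
  obtain ⟨x, hx⟩ := (hlim.eventually (eventually_gt_atTop ((n + 1 : ℕ) : ℝ))).exists
  exact absurd hx (not_lt.mpr (hbound x))

end Literature.NumberTheory.Sieve
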